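import Literature.NumberTheory.DiophantineGeometry.TwoLayerPowerLineBelyiMap
import HarnessLib

/-!
# Coverings of signature `(2, 3, 2m)` for all `m`: two Kummer layers over the dihedral seed

Topic: `Literature/NumberTheory/DiophantineGeometry`. Theorem-only file (no definition, no named
fact) in the chain attached to the named fact `AbcWave0.darmonGranville1995_thm_2` and to Pasten's
Lemma 6.10 (`Literature.NumberTheory.EllipticCurves.PastenShimura2024_lemma_6_10`, whose Diophantine
input is Darmon–Granville's theorem at the ONE signature `(L, 2, 3)`, see
`PastenValuationProductLemma610OfFaltings`). After `FermatFunctionFieldBelyiMap` (`(n, n, n)`),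
`PowerLineRadicalBelyiMap` (`(p, q, p)`) and `TwoLayerPowerLineBelyiMap` (`(n, q, n)`), this file
constructs EXPLICITLY, in the tree's function-field language and in exactly the shape consumed by
`finite_properSolutions_of_belyiMap_of_faltings` (`AbcDarmonGranvilleSignatureReduction`), a covering
of `ℙ¹` of signature `(2, 3, 2m)` over a number field for every `m ≥ 1`
(`AlgFunctionField.exists_belyiMap_signature_two_three_even`) — so that Darmon–Granville's Theorem 2
holds for the signatures `(2, 3, r)`, `r ≥ 8` EVEN, modulo Faltings' theorem ONLY, with no appeal to
the Riemann existence theorem (`finite_properSolutions_signature_two_three_even_of_faltings`,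
`finite_properSolutions_signature_even_two_three_of_faltings`).

## The construction (classically: the Fermat curve of exponent `m` over the `λ`-line over the `j`-line)

Let `K` be a field of characteristic `0` containing a primitive cube root of unity `ζ`
(`ζ² + ζ + 1 = 0`; over `ℚ` we take the cyclotomic field `ℚ(ζ₃)`), and on the line `K(t)` the
**dihedral seed**
`𝔣 = ((t³ + 1)/(t³ - 1))²`, `𝔣 - 1 = 4t³/(t³ - 1)²`,
the quotient map of `ℙ¹` by the group `S₃ = ⟨t ↦ ζ t, t ↦ 1/t⟩`, a Belyi function of degree `6` with:
zeros of order `2` (at `t³ = -1`), zeros of `𝔣 - 1` of order `3` (at `t = 0, ∞`), poles of order `2`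
(at `t³ = 1`, i.e. `t ∈ {1, ζ, ζ²}`), and unramified over every other closed point of the `𝔣`-line
(`seed_cases`, `seed_elsewhere`). Two Kummer layers of degree `m`,
`F₃ = K(t)(g₃)`, `g₃^m = h₃ = (t - 1)(t - ζ)^{m-1}`, and `F₄ = F₃(g₄)`, `g₄^m = h₄ = (t - 1)(t - ζ²)^{m-1}`,
then multiply the ramification above each of the three poles `t = 1, ζ, ζ²` by exactly `m` and are
unramified everywhere else (Stichtenoth Prop. 3.7.3 in the two extreme cases `m ∣ v(h)`,
`gcd(v(h), m) = 1` of the tree's `FunctionFieldRadicalLayerSignature`): above `t = 1` layer 3 is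
totally ramified (`v(h₃) = 1`) and layer 4 unramified (`v(h₄) = m · 1`); above `t = ζ` layer 3 is
totally ramified (`v(h₃) = m - 1`) and layer 4 unramified (`v(h₄) = 0`); above `t = ζ²` layer 3 is
unramified (`v(h₃) = 0`) and layer 4 totally ramified (`v(h₄) = m - 1`); above `t = 0`, `t = ∞`,
`t³ = -1` and the other closed points both radicands have order `0` or `-m`. Hence `𝔣 ∈ F₄` has zeros
of order `2`, `𝔣 - 1` zeros of order `3`, poles of order `2m`, and `F₄/K(𝔣)` is unramified over the
other closed points; finally `K` is replaced by the full constant field of `F₄`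
(`exists_fullConstantField_of_signature`). (`F₄` is the function field of the Fermat curve
`x^m + y^m = z^m` over `K`, and `𝔣` the composite `Fermat → ℙ¹_λ → ℙ¹_j`, up to normalisation.)

The one new tool is **`pullback_separable`** (§A): for coprime `A, B ∈ K[X]` such that every
irreducible factor of the Wronskian `A'B - AB'` divides `A`, `B` or `A - B` (the critical values of
`A/B` lie among `0, ∞, 1`), the homogenised pull-back `Ñ = Σ cᵢ Aⁱ B^{d-i}` of any monic irreducible
`π₀ = Σ cᵢ Xⁱ ∉ {X, X - 1}` is separable; with `v_P(Ñ(t)) = 1` for separable polynomials on the line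
(`PlaceOver.ord_aeval_eq_one_of_separable_of_finrank_eq_one`) this gives the unramifiedness of a
rational seed `A(t)/B(t)` over the closed points `π₀ ∉ {X, X - 1}` by a finite computation (here
`A = (X³ + 1)²`, `B = (X³ - 1)²`, `A'B - AB' = -12 X²(X³ + 1)(X³ - 1)`, `A - B = 4X³`).

What is NOT here. For `gcd(r, 6) = 1` (`r = 7, 11, 13, 25, …`) the triangle group `Δ(2, 3, r)` is
perfect, so every covering of signature dividing `(2, 3, r)` has non-solvable monodromy and no tower
of Kummer layers over a rational seed exists; those signatures still need the Riemann existence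
theorem (the named fact `exists_signatureCover_numberField`) or the modular curves `X(r)`. The odd
multiples of `3` (`(2, 3, 3m)`, tetrahedral seed) are not treated in this file.

## References

* H. Darmon, A. Granville, *On the equations `z^m = F(x, y)` and `A x^p + B y^q = C z^r`*, Bull. London
  Math. Soc. 27 (1995) 513–543: Theorem 2 (p. 515), Prop. 3.1 (p. 525). [DarmonGranville1995]
* H. Stichtenoth, *Algebraic Function Fields and Codes*, GTM 254, 2009: Prop. 3.7.3 (Kummer
  extensions), Thm. 3.1.11, Prop. 1.1.5, Cor. 1.1.20. [Stichtenoth2009]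
* H. Pasten, *Shimura curves and the abc conjecture*, J. Number Theory 254 (2024) 214–335
  (arXiv:1705.09251), §6.5, Lemma 6.10. [PastenShimura2024]
-/

noncomputable section

open scoped Classical Polynomial IntermediateField

namespace Literature.NumberTheory.DiophantineGeometry

open Polynomial

universe u v

namespace AlgFunctionField

/-! ### A. The homogenised pull-back `Ñ = Σ cᵢ Aⁱ B^{d-i}` of a closed point `π₀ = Σ cᵢ Xⁱ` under `A/B` -/

section Pullback

variable {K : Type u} [Field K]

/-- One term of `B Ñ' - d B' Ñ = W M̃`: for `i, k ∈ ℕ`,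
`B (c Aⁱ Bᵏ)' - (i + k) B' (c Aⁱ Bᵏ) = (A' B - A B') (c i A^{i-1} Bᵏ)`. [folklore] -/
private theorem pullback_term_identity (c : K) (A B : K[X]) (i k : ℕ) :
    B * derivative (C c * A ^ i * B ^ k) - C ((i + k : ℕ) : K) * derivative B * (C c * A ^ i * B ^ k) =
      (derivative A * B - A * derivative B) * (C (c * i) * A ^ (i - 1) * B ^ k) := by
  rcases Nat.eq_zero_or_pos i with rfl | hi
  · rcases Nat.eq_zero_or_pos k with rfl | hk
    · simp
    · obtain ⟨k', rfl⟩ := Nat.exists_eq_add_of_lt hk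
      simp only [zero_add, pow_zero, mul_one, derivative_mul, derivative_C, zero_mul,
        derivative_pow_succ, Nat.cast_add, Nat.cast_one, Nat.cast_zero, map_add, map_one,
        map_zero, mul_zero, Nat.zero_sub, pow_zero]
      ring
  · obtain ⟨i', rfl⟩ := Nat.exists_eq_add_of_lt hi
    rcases Nat.eq_zero_or_pos k with rfl | hk
    · simp only [zero_add, pow_zero, mul_one, derivative_mul, derivative_C, zero_mul,
        derivative_pow_succ, Nat.cast_add, Nat.cast_one, map_add, map_one,
        map_mul, add_zero, Nat.add_sub_cancel, map_natCast]
      ring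
    · obtain ⟨k', rfl⟩ := Nat.exists_eq_add_of_lt hk
      simp only [zero_add, derivative_mul, derivative_C, zero_mul, derivative_pow_succ, Nat.cast_add,
        Nat.cast_one, map_add, map_one, map_mul, Nat.add_sub_cancel, map_natCast]
      ring

/-- **The derivative identity for the homogenised pull-back.** For `π₀ = Σ_{i ≤ d} cᵢ Xⁱ`,
`Ñ := Σ cᵢ Aⁱ B^{d-i}` and `M̃ := Σ cᵢ i A^{i-1} B^{d-i}` one has `B Ñ' - d B' Ñ = (A' B - A B') M̃`
(formally, `Ñ = B^d π₀(A/B)` and `M̃ = B^{d-1} π₀'(A/B)`). [folklore] -/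
theorem pullback_derivative_identity (π₀ A B : K[X]) :
    B * derivative (∑ i ∈ Finset.range (π₀.natDegree + 1),
        C (π₀.coeff i) * A ^ i * B ^ (π₀.natDegree - i)) -
      C (π₀.natDegree : K) * derivative B *
        (∑ i ∈ Finset.range (π₀.natDegree + 1), C (π₀.coeff i) * A ^ i * B ^ (π₀.natDegree - i)) =
      (derivative A * B - A * derivative B) *
        ∑ i ∈ Finset.range (π₀.natDegree + 1),
          C (π₀.coeff i * i) * A ^ (i - 1) * B ^ (π₀.natDegree - i) := by
  rw [derivative_sum, Finset.mul_sum, Finset.mul_sum, Finset.mul_sum, ← Finset.sum_sub_distrib]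
  refine Finset.sum_congr rfl fun i hi => ?_
  have hid : i ≤ π₀.natDegree := Nat.lt_succ_iff.mp (Finset.mem_range.mp hi)
  have h := pullback_term_identity (π₀.coeff i) A B i (π₀.natDegree - i)
  rw [Nat.add_sub_cancel' hid] at h
  rw [← h]

variable {S : Type v} [Field S] [Algebra K S]

/-- `Ñ(x) = B(x)^d π₀(A(x)/B(x))` wherever `B(x) ≠ 0`. [folklore] -/
theorem aeval_pullback_eq (π₀ A B : K[X]) {x : S} (hB : aeval x B ≠ 0) :
    aeval x (∑ i ∈ Finset.range (π₀.natDegree + 1), C (π₀.coeff i) * A ^ i * B ^ (π₀.natDegree - i)) =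
      aeval x B ^ π₀.natDegree * aeval (aeval x A / aeval x B) π₀ := by
  rw [aeval_eq_sum_range (aeval x A / aeval x B), map_sum, Finset.mul_sum]
  refine Finset.sum_congr rfl fun i hi => ?_
  have hid : i ≤ π₀.natDegree := Nat.lt_succ_iff.mp (Finset.mem_range.mp hi)
  rw [map_mul, map_mul, aeval_C, map_pow, map_pow, Algebra.smul_def, div_pow,
    ← Nat.add_sub_cancel' hid, pow_add, Nat.add_sub_cancel_left]
  field_simp

/-- `M̃(x) = B(x)^{d-1} π₀'(A(x)/B(x))` wherever `B(x) ≠ 0` (`d = deg π₀ ≥ 1`). [folklore] -/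
theorem aeval_pullback_derivative_eq (π₀ A B : K[X]) (hd : π₀.natDegree ≠ 0) {x : S}
    (hB : aeval x B ≠ 0) :
    aeval x (∑ i ∈ Finset.range (π₀.natDegree + 1),
        C (π₀.coeff i * i) * A ^ (i - 1) * B ^ (π₀.natDegree - i)) =
      aeval x B ^ (π₀.natDegree - 1) * aeval (aeval x A / aeval x B) (derivative π₀) := by
  obtain ⟨d, hd⟩ := Nat.exists_eq_succ_of_ne_zero hd
  have hlt : (derivative π₀).natDegree < d + 1 := by
    have h := natDegree_derivative_lt (p := π₀) (by omega)
    omega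
  rw [hd, Nat.succ_sub_one, Finset.sum_range_succ', map_add, map_sum]
  simp only [Nat.cast_zero, mul_zero, map_zero, zero_mul, add_zero]
  rw [aeval_eq_sum_range' hlt, Finset.mul_sum]
  refine Finset.sum_congr rfl fun i hi => ?_
  have hid : i ≤ d := Nat.lt_succ_iff.mp (Finset.mem_range.mp hi)
  rw [map_mul, map_mul, aeval_C, map_pow, map_pow, Algebra.smul_def, div_pow, coeff_derivative,
    Nat.add_sub_cancel, Nat.succ_sub_succ_eq_sub]
  obtain ⟨k, rfl⟩ := Nat.exists_eq_add_of_le hid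
  rw [Nat.add_sub_cancel_left, pow_add]
  push_cast
  field_simp

omit [Algebra K S] in
/-- `π₀(0) = π₀.eval 0` in any `K`-algebra. [folklore] -/
private theorem aeval_zero_eq (π₀ : K[X]) [Algebra K S] :
    aeval (0 : S) π₀ = algebraMap K S (π₀.eval 0) := by
  rw [aeval_def, eval₂_at_zero, coeff_zero_eq_eval_zero]

omit [Algebra K S] in
/-- `π₀(1) = π₀.eval 1` in any `K`-algebra. [folklore] -/
private theorem aeval_one_eq (π₀ : K[X]) [Algebra K S] :
    aeval (1 : S) π₀ = algebraMap K S (π₀.eval 1) := by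
  rw [aeval_def, eval₂_at_one]

/-- **Separability of the pull-back of a closed point.** Let `A, B ∈ K[X]` be coprime (`char K = 0`)
and suppose every irreducible factor of the Wronskian `W = A' B - A B'` divides `A`, `B` or `A - B`
(the critical values of `A/B` are among `0, ∞, 1`). Then for every monic irreducible
`π₀ ∉ {X, X - 1}` the homogenised pull-back `Ñ = Σ cᵢ Aⁱ B^{d-i}` (`π₀ = Σ cᵢ Xⁱ`, `d = deg π₀`),
if non-zero, is separable. Proof: if `ρ² ∣ Ñ` with `ρ` irreducible then `ρ ∤ B` (else `ρ ∣ A^d`),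
so in `κ = K[X]/(ρ)` the class `θ` of `A/B` is a root of `π₀`; from `ρ ∣ Ñ'` and
`B Ñ' - d B' Ñ = W M̃` either `ρ ∣ M̃`, i.e. `π₀'(θ) = 0`, contradicting the separability of `π₀`,
or `ρ ∣ W`, whence `θ ∈ {0, 1}` and `π₀ ∈ {X, X - 1}`. [folklore] -/
theorem pullback_separable [CharZero K] {A B π₀ : K[X]} (hπi : Irreducible π₀) (hπm : π₀.Monic)
    (hπX : π₀ ≠ X) (hπX1 : π₀ ≠ X - 1) (hAB : IsCoprime A B)
    (hW : ∀ ρ : K[X], Irreducible ρ → ρ ∣ derivative A * B - A * derivative B →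
      ρ ∣ A ∨ ρ ∣ B ∨ ρ ∣ A - B)
    (hN0 : (∑ i ∈ Finset.range (π₀.natDegree + 1),
      C (π₀.coeff i) * A ^ i * B ^ (π₀.natDegree - i)) ≠ 0) :
    (∑ i ∈ Finset.range (π₀.natDegree + 1),
      C (π₀.coeff i) * A ^ i * B ^ (π₀.natDegree - i)).Separable := by
  set d := π₀.natDegree with hd
  set N : K[X] := ∑ i ∈ Finset.range (d + 1), C (π₀.coeff i) * A ^ i * B ^ (d - i) with hN
  have hd0 : d ≠ 0 := (Irreducible.natDegree_pos hπi).ne'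
  rw [PerfectField.separable_iff_squarefree]
  intro x hx
  by_contra hxu
  have hx0 : x ≠ 0 := by
    rintro rfl
    exact hN0 (zero_dvd_iff.mp (dvd_trans (dvd_mul_right 0 0) hx))
  obtain ⟨ρ, hρ, hρx⟩ := WfDvdMonoid.exists_irreducible_factor hxu hx0
  have hρN2 : ρ * ρ ∣ N := (mul_dvd_mul hρx hρx).trans hx
  have hρN : ρ ∣ N := (dvd_mul_right ρ ρ).trans hρN2
  have hρN' : ρ ∣ derivative N := by
    obtain ⟨g, hg⟩ := hρN2
    rw [hg, derivative_mul, derivative_mul]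
    exact dvd_add (dvd_mul_of_dvd_left (dvd_add (dvd_mul_left _ _) (dvd_mul_right _ _)) _)
      (dvd_mul_of_dvd_left (dvd_mul_right _ _) _)
  have hρp : Prime ρ := hρ.prime
  -- `ρ ∤ B`
  have hρB : ¬ ρ ∣ B := by
    intro hB
    -- `N = A^d + Σ_{i < d} cᵢ Aⁱ B^{d-i}`
    have hsplit : N = C (π₀.coeff d) * A ^ d * B ^ (d - d) +
        ∑ i ∈ Finset.range d, C (π₀.coeff i) * A ^ i * B ^ (d - i) := by
      rw [hN, Finset.sum_range_succ, add_comm]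
    have hlow : ρ ∣ ∑ i ∈ Finset.range d, C (π₀.coeff i) * A ^ i * B ^ (d - i) := by
      refine Finset.dvd_sum fun i hi => ?_
      have hid : i < d := Finset.mem_range.mp hi
      obtain ⟨k, hk⟩ := Nat.exists_eq_add_of_lt hid
      rw [hk, show i + k + 1 - i = k + 1 by omega, pow_succ]
      exact dvd_mul_of_dvd_right (hB.trans (dvd_mul_left B (B ^ k))) _
    have hlead : ρ ∣ C (π₀.coeff d) * A ^ d * B ^ (d - d) := by
      have h := (dvd_sub hρN hlow)
      rwa [hsplit, add_sub_cancel_right] at h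
    rw [Nat.sub_self, pow_zero, mul_one, show π₀.coeff d = 1 from hπm, C_1, one_mul] at hlead
    have hρA : ρ ∣ A := hρp.dvd_of_dvd_pow hlead
    obtain ⟨a, b, hab⟩ := hAB
    have h1 : ρ ∣ (1 : K[X]) := hab ▸ dvd_add (dvd_mul_of_dvd_right hρA _) (dvd_mul_of_dvd_right hB _)
    exact hρ.not_isUnit (isUnit_of_dvd_one h1)
  -- the residue field `κ = K[X]/(ρ)` and `θ = A/B mod ρ`
  haveI := Fact.mk hρ
  set φ : K[X] →+* AdjoinRoot ρ := AdjoinRoot.mk ρ with hφ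
  have hφ_aeval : ∀ p : K[X], φ p = aeval (AdjoinRoot.root ρ) p := fun p => by
    rw [hφ, AdjoinRoot.aeval_eq]
  have hφ0 : ∀ p : K[X], φ p = 0 ↔ ρ ∣ p := fun p => AdjoinRoot.mk_eq_zero
  have hb : aeval (AdjoinRoot.root ρ) B ≠ 0 := by
    rw [← hφ_aeval, Ne, hφ0]; exact hρB
  set θ : AdjoinRoot ρ := aeval (AdjoinRoot.root ρ) A / aeval (AdjoinRoot.root ρ) B with hθ
  have hθroot : aeval θ π₀ = 0 := by
    have h := (hφ0 N).2 hρN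
    rw [hφ_aeval, hN, aeval_pullback_eq π₀ A B hb] at h
    exact (mul_eq_zero.mp h).resolve_left (pow_ne_zero _ hb)
  -- `ρ ∣ W M̃`
  have hWM : ρ ∣ (derivative A * B - A * derivative B) *
      ∑ i ∈ Finset.range (d + 1), C (π₀.coeff i * i) * A ^ (i - 1) * B ^ (d - i) := by
    rw [← pullback_derivative_identity π₀ A B]
    exact dvd_sub (dvd_mul_of_dvd_right hρN' _) (dvd_mul_of_dvd_right hρN _)
  rcases hρp.dvd_or_dvd hWM with hρW | hρM
  · -- `ρ ∣ W`: `θ ∈ {0, 1}`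
    rcases hW ρ hρ hρW with hρA | hρB' | hρAB
    · have ha : aeval (AdjoinRoot.root ρ) A = 0 := by rw [← hφ_aeval, hφ0]; exact hρA
      have hθ0 : θ = 0 := by rw [hθ, ha, zero_div]
      rw [hθ0, aeval_zero_eq, map_eq_zero] at hθroot
      apply hπX
      have h := PlaceOver.eq_X_sub_C_of_irreducible_of_eval_eq_zero hπi hπm hθroot
      rwa [map_zero, sub_zero] at h
    · exact hρB hρB'
    · have hab : aeval (AdjoinRoot.root ρ) A = aeval (AdjoinRoot.root ρ) B := by
        rw [← sub_eq_zero, ← map_sub, ← hφ_aeval, hφ0]; exact hρAB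
      have hθ1 : θ = 1 := by rw [hθ, hab, div_self hb]
      rw [hθ1, aeval_one_eq, map_eq_zero] at hθroot
      apply hπX1
      have h := PlaceOver.eq_X_sub_C_of_irreducible_of_eval_eq_zero hπi hπm hθroot
      rwa [map_one] at h
  · -- `ρ ∣ M̃`: `π₀'(θ) = 0`
    have h := (hφ0 _).2 hρM
    rw [hφ_aeval, aeval_pullback_derivative_eq π₀ A B hd0 hb] at h
    have h' : aeval θ (derivative π₀) = 0 := (mul_eq_zero.mp h).resolve_left (pow_ne_zero _ hb)
    exact (PerfectField.separable_of_irreducible hπi).aeval_derivative_ne_zero hθroot h'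

end Pullback

/-! ### B. A primitive cube root of unity `ζ`: `ζ² + ζ + 1 = 0` -/

section CubeRoot

variable {K : Type u} [Field K]

/-- `ζ² + ζ + 1 = 0 ⇒ ζ³ = 1`. [folklore] -/
theorem cubeRoot_pow_three {ζ : K} (hζ : ζ ^ 2 + ζ + 1 = 0) : ζ ^ 3 = 1 := by
  linear_combination (ζ - 1) * hζ

/-- `ζ² + ζ + 1 = 0 ⇒ (ζ²)² + ζ² + 1 = 0`: `ζ²` is the other primitive cube root of unity. [folklore] -/
theorem cubeRoot_sq {ζ : K} (hζ : ζ ^ 2 + ζ + 1 = 0) : (ζ ^ 2) ^ 2 + ζ ^ 2 + 1 = 0 := by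
  linear_combination (ζ ^ 2 - ζ + 1) * hζ

/-- `ζ ≠ 1` (`char K = 0`). [folklore] -/
theorem cubeRoot_ne_one [CharZero K] {ζ : K} (hζ : ζ ^ 2 + ζ + 1 = 0) : ζ ≠ 1 := by
  rintro rfl
  norm_num at hζ

/-- `ζ ≠ 0`. [folklore] -/
theorem cubeRoot_ne_zero {ζ : K} (hζ : ζ ^ 2 + ζ + 1 = 0) : ζ ≠ 0 := by
  rintro rfl
  norm_num at hζ

/-- `ζ² ≠ ζ` (`char K = 0`). [folklore] -/
theorem cubeRoot_sq_ne_self [CharZero K] {ζ : K} (hζ : ζ ^ 2 + ζ + 1 = 0) : ζ ^ 2 ≠ ζ := by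
  intro h
  have h0 : ζ * (ζ - 1) = 0 := by linear_combination h
  rcases mul_eq_zero.mp h0 with h1 | h1
  · exact cubeRoot_ne_zero hζ h1
  · exact cubeRoot_ne_one hζ (sub_eq_zero.mp h1)

/-- `X³ - 1 = (X - 1)(X - ζ)(X - ζ²)`. [folklore] -/
theorem X_pow_three_sub_one_eq {ζ : K} (hζ : ζ ^ 2 + ζ + 1 = 0) :
    (X ^ 3 - 1 : K[X]) = (X - C 1) * (X - C ζ) * (X - C (ζ ^ 2)) := by
  have h3 := cubeRoot_pow_three hζ
  have e1 : (X - C 1) * (X - C ζ) * (X - C (ζ ^ 2)) =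
      (X ^ 3 - C (1 + ζ + ζ ^ 2) * X ^ 2 + C (ζ + ζ ^ 2 + ζ ^ 3) * X - C (ζ ^ 3) : K[X]) := by
    simp only [map_add, map_pow, map_one]
    ring
  rw [e1, h3, show (1 + ζ + ζ ^ 2 : K) = 0 by linear_combination hζ,
    show (ζ + ζ ^ 2 + 1 : K) = 0 by linear_combination hζ, map_zero, map_one]
  ring

/-- In a field extension `κ/K`: the cube roots of unity are `1, ζ, ζ²`. [folklore] -/
theorem eq_of_pow_three_eq_one {ζ : K} (hζ : ζ ^ 2 + ζ + 1 = 0) {κ : Type v} [Field κ] [Algebra K κ]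
    {r : κ} (hr : r ^ 3 = 1) : r = 1 ∨ r = algebraMap K κ ζ ∨ r = algebraMap K κ (ζ ^ 2) := by
  have h : aeval r (X ^ 3 - 1 : K[X]) = 0 := by simp [hr]
  rw [X_pow_three_sub_one_eq hζ, map_mul, map_mul] at h
  simp only [map_sub, aeval_X, aeval_C, map_one] at h
  rcases mul_eq_zero.mp h with h | h
  · rcases mul_eq_zero.mp h with h | h
    · exact Or.inl (sub_eq_zero.mp h)
    · exact Or.inr (Or.inl (sub_eq_zero.mp h))
  · exact Or.inr (Or.inr (sub_eq_zero.mp h))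

end CubeRoot

/-! ### C. The seed `𝔣 = ((t³ + 1)/(t³ - 1))²` on the line `K(t)` -/

/-- The seed `𝔣 = ((t³ + 1)/(t³ - 1))²` on the line `K(t)` (local notation of this file). -/
local notation3 "𝔣(" K ")" =>
  ((((RatFunc.X : RatFunc K) ^ 3 + 1) / ((RatFunc.X : RatFunc K) ^ 3 - 1)) ^ 2 : RatFunc K)

/-- The radicands `𝔥(K, c, b) = (t - 1)(t - c)^b` of the two Kummer layers (local notation). -/
local notation3 "𝔥(" K ", " c ", " b ")" =>
  (aeval (RatFunc.X : RatFunc K) ((X - C 1) * (X - C c) ^ b) : RatFunc K)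

section Seed

variable {K : Type u} [Field K]

/-- `t³ + 1`, `t³ - 1`, `t` and the seed are non-zero on the line. [folklore] -/
theorem seed_ne_zero :
    ((RatFunc.X : RatFunc K) ^ 3 + 1 ≠ 0) ∧ ((RatFunc.X : RatFunc K) ^ 3 - 1 ≠ 0) ∧
      (RatFunc.X : RatFunc K) ≠ 0 ∧ 𝔣(K) ≠ 0 := by
  have hN : (RatFunc.X : RatFunc K) ^ 3 + 1 ≠ 0 := by
    have h := aeval_ratFunc_X_ne_zero (K := K) (p := X ^ 3 + 1) (by
      rw [← C_1]; exact X_pow_add_C_ne_zero (by norm_num) 1)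
    simpa using h
  have hD : (RatFunc.X : RatFunc K) ^ 3 - 1 ≠ 0 := by
    have h := aeval_ratFunc_X_ne_zero (K := K) (p := X ^ 3 - 1) (by
      rw [← C_1]; exact X_pow_sub_C_ne_zero (by norm_num) 1)
    simpa using h
  exact ⟨hN, hD, RatFunc.X_ne_zero, pow_ne_zero _ (div_ne_zero hN hD)⟩

/-- `𝔣 - 1 = 4 t³ / (t³ - 1)²`. [folklore] -/
theorem seed_sub_one :
    𝔣(K) - 1 = 4 * (RatFunc.X : RatFunc K) ^ 3 / ((RatFunc.X : RatFunc K) ^ 3 - 1) ^ 2 := by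
  obtain ⟨-, hD, -, -⟩ := seed_ne_zero (K := K)
  field_simp
  ring

/-- `𝔣 = A(t)/B(t)` with `A = (X³ + 1)²`, `B = (X³ - 1)²`. [folklore] -/
theorem seed_eq_aeval_div :
    𝔣(K) = aeval (RatFunc.X : RatFunc K) ((X ^ 3 + 1) ^ 2 : K[X]) /
      aeval (RatFunc.X : RatFunc K) ((X ^ 3 - 1) ^ 2 : K[X]) := by
  simp [div_pow]

variable [CharZero K]

/-- `v_P(t³ + 1)` and `v_P(t³ - 1)` are not both positive (their difference is the unit `2`).
[folklore] -/
theorem seed_not_both_pos (P : PlaceOver K (RatFunc K))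
    (htO : (RatFunc.X : RatFunc K) ∈ P.toValuationSubring)
    (hN : 0 < P.ord ((RatFunc.X : RatFunc K) ^ 3 + 1)) (hD : 0 < P.ord ((RatFunc.X : RatFunc K) ^ 3 - 1)) :
    False := by
  have hN' : 0 < P.ord (aeval (RatFunc.X : RatFunc K) (X ^ 3 + 1 : K[X])) := by simpa using hN
  have hD' : 0 < P.ord (aeval (RatFunc.X : RatFunc K) (X ^ 3 - 1 : K[X])) := by simpa using hD
  obtain ⟨hN0, hD0, -, -⟩ := seed_ne_zero (K := K)
  rw [P.ord_aeval_pos_iff htO (by simpa using hN0)] at hN'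
  rw [P.ord_aeval_pos_iff htO (by simpa using hD0)] at hD'
  simp only [map_add, map_sub, map_pow, aeval_X, map_one] at hN' hD'
  have h2 : (2 : P.residueField) = 0 := by linear_combination hN' - hD'
  have h2' : algebraMap K P.residueField 2 = 0 := by rw [map_ofNat]; exact h2
  exact two_ne_zero ((map_eq_zero _).1 h2')

omit [CharZero K] in
/-- `v_P(π₀(x)) = 0` at a zero `P` of `x - 1` when `π₀(1) ≠ 0`. [folklore] -/
theorem ord_aeval_eq_zero_of_ord_sub_one_pos {F : Type v} [Field F] [Algebra K F]
    [IsAlgFunctionField K F] (P : PlaceOver K F) {x : F} (hx : 0 < P.ord (x - 1)) {π₀ : K[X]}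
    (h1 : π₀.eval 1 ≠ 0) : P.ord (aeval x π₀) = 0 := by
  have hcomp : aeval x π₀ = aeval (x - 1) (π₀.comp (X + C 1)) := by
    rw [aeval_comp]; simp
  rw [hcomp]
  refine (P.ord_aeval_eq_zero_of_eval_ne_zero hx ?_).2
  simpa [eval_comp] using h1

/-- **The five kinds of places of the line for the seed.** At every place `P` of `K(t)` exactly one of:
(∞) `v(t) < 0`, `v(𝔣) = 0`, `v(𝔣 - 1) = 3`; (0) `v(t) > 0`, `v(𝔣) = 0`, `v(𝔣 - 1) = 3`;
(zeros) `t ∈ 𝒪_P`, `v(t³ - 1) = 0`, `v(𝔣) = 2`; (poles) `t ∈ 𝒪_P`, `v(t³ - 1) = 1`, `v(𝔣) = v(𝔣 - 1) = -2`;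
(generic) `t ∈ 𝒪_P`, `v(t) = v(t³ ± 1) = v(𝔣) = v(𝔣 - 1) = 0` — together with the value of
`v(π₀(𝔣))` in the first four cases. [folklore] -/
theorem seed_cases (P : PlaceOver K (RatFunc K)) :
    (P.ord (RatFunc.X : RatFunc K) < 0 ∧ P.ord 𝔣(K) = 0 ∧ P.ord (𝔣(K) - 1) = 3 ∧
        ∀ π₀ : K[X], π₀.eval 1 ≠ 0 → P.ord (aeval 𝔣(K) π₀) = 0) ∨
      (0 < P.ord (RatFunc.X : RatFunc K) ∧ P.ord 𝔣(K) = 0 ∧ P.ord (𝔣(K) - 1) = 3 ∧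
        ∀ π₀ : K[X], π₀.eval 1 ≠ 0 → P.ord (aeval 𝔣(K) π₀) = 0) ∨
      ((RatFunc.X : RatFunc K) ∈ P.toValuationSubring ∧ P.ord ((RatFunc.X : RatFunc K) ^ 3 - 1) = 0 ∧
        P.ord 𝔣(K) = 2 ∧ P.ord (𝔣(K) - 1) = 0 ∧
        ∀ π₀ : K[X], π₀.eval 0 ≠ 0 → P.ord (aeval 𝔣(K) π₀) = 0) ∨
      ((RatFunc.X : RatFunc K) ∈ P.toValuationSubring ∧ P.ord ((RatFunc.X : RatFunc K) ^ 3 - 1) = 1 ∧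
        P.ord 𝔣(K) = -2 ∧ P.ord (𝔣(K) - 1) = -2 ∧
        ∀ π₀ : K[X], π₀ ≠ 0 → P.ord (aeval 𝔣(K) π₀) = π₀.natDegree * (-2)) ∨
      ((RatFunc.X : RatFunc K) ∈ P.toValuationSubring ∧ P.ord (RatFunc.X : RatFunc K) = 0 ∧
        P.ord ((RatFunc.X : RatFunc K) ^ 3 - 1) = 0 ∧ P.ord ((RatFunc.X : RatFunc K) ^ 3 + 1) = 0 ∧
        P.ord 𝔣(K) = 0 ∧ P.ord (𝔣(K) - 1) = 0) := by
  have hut := RatFunc.transcendental_X (K := K)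
  have hu1 := finrank_adjoin_ratFunc_X (K := K)
  obtain ⟨hN0, hD0, ht0, hf0⟩ := seed_ne_zero (K := K)
  set t : RatFunc K := RatFunc.X with ht
  have h4 : P.ord (4 : RatFunc K) = 0 := by
    rw [← map_ofNat (algebraMap K (RatFunc K)) 4]
    exact PlaceOver.ord_algebraMap_holds P (by norm_num)
  have h40 : (4 : RatFunc K) ≠ 0 := by
    rw [← map_ofNat (algebraMap K (RatFunc K)) 4, _root_.map_ne_zero]; norm_num
  -- the orders of `𝔣` and `𝔣 - 1` in terms of those of `t`, `t³ + 1`, `t³ - 1`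
  have hordf : P.ord 𝔣(K) = 2 * (P.ord (t ^ 3 + 1) - P.ord (t ^ 3 - 1)) := by
    rw [P.ord_pow (div_ne_zero hN0 hD0), P.ord_div hN0 hD0]; rfl
  have hordf1 : P.ord (𝔣(K) - 1) = 3 * P.ord t - 2 * P.ord (t ^ 3 - 1) := by
    rw [seed_sub_one, P.ord_div (mul_ne_zero h40 (pow_ne_zero _ ht0)) (pow_ne_zero _ hD0),
      P.ord_mul_eq h40 (pow_ne_zero _ ht0), h4, P.ord_pow ht0, P.ord_pow hD0]
    push_cast; ring
  have haN : aeval t (X ^ 3 + 1 : K[X]) = t ^ 3 + 1 := by simp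
  have haD : aeval t (X ^ 3 - 1 : K[X]) = t ^ 3 - 1 := by simp
  have hpN : (X ^ 3 + 1 : K[X]) ≠ 0 := by rw [← C_1]; exact X_pow_add_C_ne_zero (by norm_num) 1
  have hpD : (X ^ 3 - 1 : K[X]) ≠ 0 := by rw [← C_1]; exact X_pow_sub_C_ne_zero (by norm_num) 1
  have hdN : (X ^ 3 + 1 : K[X]).natDegree = 3 := by rw [← C_1, natDegree_X_pow_add_C]
  have hdD : (X ^ 3 - 1 : K[X]).natDegree = 3 := by rw [← C_1, natDegree_X_pow_sub_C]
  rcases lt_trichotomy (P.ord t) 0 with hneg | hzero | hpos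
  · -- (∞)
    left
    have ht1 : P.ord t = -1 := P.ord_eq_neg_one_of_finrank_eq_one hut hu1 hneg
    have hN : P.ord (t ^ 3 + 1) = -3 := by
      rw [← haN, (P.ord_aeval_of_ord_neg hneg hpN).2, hdN, ht1]; norm_num
    have hD : P.ord (t ^ 3 - 1) = -3 := by
      rw [← haD, (P.ord_aeval_of_ord_neg hneg hpD).2, hdD, ht1]; norm_num
    have hf1 : P.ord (𝔣(K) - 1) = 3 := by rw [hordf1, ht1, hD]; norm_num
    refine ⟨hneg, by rw [hordf, hN, hD]; norm_num, hf1, fun π₀ h1 => ?_⟩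
    exact ord_aeval_eq_zero_of_ord_sub_one_pos P (by rw [hf1]; norm_num) h1
  · -- `t ∈ 𝒪_P`, `v(t) = 0`
    right; right
    have htO : t ∈ P.toValuationSubring := (P.mem_toValuationSubring_iff_ord_nonneg ht0).2 hzero.ge
    have hNnn : 0 ≤ P.ord (t ^ 3 + 1) := by rw [← haN]; exact P.ord_nonneg_of_mem (P.aeval_mem htO _)
    have hDnn : 0 ≤ P.ord (t ^ 3 - 1) := by rw [← haD]; exact P.ord_nonneg_of_mem (P.aeval_mem htO _)
    have h3K : ((3 : ℕ) : K) ≠ 0 := by norm_num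
    rcases hNnn.lt_or_eq with hNpos | hNz
    · -- (zeros): `v(t³ + 1) = 1`, `v(t³ - 1) = 0`
      left
      have hDz : P.ord (t ^ 3 - 1) = 0 := by
        rcases hDnn.lt_or_eq with hDpos | hDz
        · exact (seed_not_both_pos P htO hNpos hDpos).elim
        · exact hDz.symm
      have hN1 : P.ord (t ^ 3 + 1) = 1 := by
        have hsep : (X ^ 3 + 1 : K[X]).Separable := by
          rw [show (X ^ 3 + 1 : K[X]) = X ^ 3 - C (-1) by rw [map_neg, C_1, sub_neg_eq_add]]
          exact separable_X_pow_sub_C (-1) h3K (by norm_num)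
        have h := P.ord_aeval_eq_one_of_separable_of_finrank_eq_one hut hu1 hsep (by rwa [haN])
        rwa [haN] at h
      have hf : P.ord 𝔣(K) = 2 := by rw [hordf, hN1, hDz]; norm_num
      refine ⟨htO, hDz, hf, by rw [hordf1, hzero, hDz]; norm_num, fun π₀ h0 => ?_⟩
      exact (P.ord_aeval_eq_zero_of_eval_ne_zero (by rw [hf]; norm_num) h0).2
    · rcases hDnn.lt_or_eq with hDpos | hDz
      · -- (poles): `v(t³ - 1) = 1`, `v(t³ + 1) = 0`
        right; left
        have hD1 : P.ord (t ^ 3 - 1) = 1 := by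
          have hsep : (X ^ 3 - 1 : K[X]).Separable := by
            rw [← C_1]; exact separable_X_pow_sub_C 1 h3K one_ne_zero
          have h := P.ord_aeval_eq_one_of_separable_of_finrank_eq_one hut hu1 hsep (by rwa [haD])
          rwa [haD] at h
        have hf : P.ord 𝔣(K) = -2 := by rw [hordf, ← hNz, hD1]; norm_num
        refine ⟨htO, hD1, hf, by rw [hordf1, hzero, hD1]; norm_num, fun π₀ hπ => ?_⟩
        rw [(P.ord_aeval_of_ord_neg (by rw [hf]; norm_num) hπ).2, hf]
      · -- (generic)
        right; right
        exact ⟨htO, hzero, hDz.symm, hNz.symm, by rw [hordf, ← hNz, ← hDz]; norm_num,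
          by rw [hordf1, hzero, ← hDz]; norm_num⟩
  · -- (0)
    right; left
    have ht1 : P.ord t = 1 := P.ord_eq_one_of_finrank_eq_one hut hu1 hpos
    have hN : P.ord (t ^ 3 + 1) = 0 := by
      rw [← haN]; exact (P.ord_aeval_eq_zero_of_eval_ne_zero hpos (p := X ^ 3 + 1) (by simp)).2
    have hD : P.ord (t ^ 3 - 1) = 0 := by
      rw [← haD]; exact (P.ord_aeval_eq_zero_of_eval_ne_zero hpos (p := X ^ 3 - 1) (by simp)).2
    have hf1 : P.ord (𝔣(K) - 1) = 3 := by rw [hordf1, ht1, hD]; norm_num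
    refine ⟨hpos, by rw [hordf, hN, hD]; norm_num, hf1, fun π₀ h1 => ?_⟩
    exact ord_aeval_eq_zero_of_ord_sub_one_pos P (by rw [hf1]; norm_num) h1

/-- **The seed has a pole**, hence is transcendental over `K`: at a zero `P` of `t³ - 1`
(which exists, `t³ - 1` being transcendental) `v_P(𝔣) = -2`, whereas an element algebraic over `K`
lies in every valuation ring. [cite: Stichtenoth2009, Prop. 1.1.5(c), Cor. 1.1.20] -/
theorem seed_transcendental : Transcendental K 𝔣(K) := by
  have hut := RatFunc.transcendental_X (K := K)
  obtain ⟨-, hD0, -, hf0⟩ := seed_ne_zero (K := K)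
  have hpD : (X ^ 3 - 1 : K[X]) ≠ 0 := by rw [← C_1]; exact X_pow_sub_C_ne_zero (by norm_num) 1
  have htr : Transcendental K (aeval (RatFunc.X : RatFunc K) (X ^ 3 - 1 : K[X])) :=
    hut.aeval (X ^ 3 - 1) (by rw [← C_1, natDegree_X_pow_sub_C]; norm_num)
      (mem_nonZeroDivisors_of_ne_zero (leadingCoeff_ne_zero.mpr hpD))
  obtain ⟨P, hP⟩ := exists_ord_pos_of_transcendental htr
  have haD : aeval (RatFunc.X : RatFunc K) (X ^ 3 - 1 : K[X]) = RatFunc.X ^ 3 - 1 := by simp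
  rw [haD] at hP
  have hpole : P.ord 𝔣(K) < 0 := by
    rcases seed_cases P with ⟨hneg, -⟩ | ⟨hpos, -⟩ | ⟨-, hD, -⟩ | ⟨-, -, hf, -⟩ | ⟨-, -, hD, -⟩
    · have h := (P.ord_aeval_of_ord_neg hneg hpD).2
      rw [haD, ← C_1, natDegree_X_pow_sub_C] at h
      rw [h] at hP
      have : (0 : ℤ) ≤ 3 * P.ord (RatFunc.X : RatFunc K) := hP.le
      omega
    · have h := (P.ord_aeval_eq_zero_of_eval_ne_zero hpos (p := X ^ 3 - 1) (by simp)).2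
      rw [haD] at h
      omega
    · omega
    · rw [hf]; norm_num
    · omega
  intro halg
  have hmem := IsAlgFunctionField.mem_valuationSubring_of_isAlgebraic P.toValuationSubring
    P.algebraMap_mem halg
  have := (P.mem_toValuationSubring_iff_ord_nonneg hf0).1 hmem
  omega

/-- The seed is not annihilated by a non-zero polynomial. [folklore] -/
theorem aeval_seed_ne_zero {π₀ : K[X]} (hπ : π₀ ≠ 0) : aeval 𝔣(K) π₀ ≠ 0 :=
  fun h => seed_transcendental (K := K) ⟨π₀, hπ, h⟩

/-- **The other closed points are unramified for the seed.** For `π₀` monic irreducible,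
`π₀ ∉ {X, X - 1}`, at every zero `P` of `π₀(𝔣)` on the line: `v_P(π₀(𝔣)) = 1`, and `t ∈ 𝒪_P`,
`v_P(t³ - 1) = 0`. By `seed_cases` such a `P` is generic, so `v_P(π₀(𝔣)) = v_P(Ñ(t))` for the
homogenised pull-back `Ñ` of `π₀` under `(X³ + 1)²/(X³ - 1)²`, which is separable by
`pullback_separable`: the Wronskian is `-12 X² (X³ + 1)(X³ - 1)`. [folklore] -/
theorem seed_elsewhere {π₀ : K[X]} (hπi : Irreducible π₀) (hπm : π₀.Monic) (hπX : π₀ ≠ X)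
    (hπX1 : π₀ ≠ X - 1) (P : PlaceOver K (RatFunc K)) (hP : 0 < P.ord (aeval 𝔣(K) π₀)) :
    P.ord (aeval 𝔣(K) π₀) = 1 ∧ (RatFunc.X : RatFunc K) ∈ P.toValuationSubring ∧
      P.ord ((RatFunc.X : RatFunc K) ^ 3 - 1) = 0 := by
  have hut := RatFunc.transcendental_X (K := K)
  have hu1 := finrank_adjoin_ratFunc_X (K := K)
  have h0 : π₀.eval 0 ≠ 0 := fun h0 => hπX (by
    have h := PlaceOver.eq_X_sub_C_of_irreducible_of_eval_eq_zero hπi hπm h0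
    rwa [map_zero, sub_zero] at h)
  have h1 : π₀.eval 1 ≠ 0 := fun h1 => hπX1 (by
    have h := PlaceOver.eq_X_sub_C_of_irreducible_of_eval_eq_zero hπi hπm h1
    rwa [map_one] at h)
  rcases seed_cases P with ⟨-, -, -, h⟩ | ⟨-, -, -, h⟩ | ⟨-, -, -, -, h⟩ | ⟨-, -, -, -, h⟩ |
    ⟨htO, -, hD, -, -, -⟩
  · rw [h π₀ h1] at hP; exact (lt_irrefl _ hP).elim
  · rw [h π₀ h1] at hP; exact (lt_irrefl _ hP).elim
  · rw [h π₀ h0] at hP; exact (lt_irrefl _ hP).elim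
  · rw [h π₀ hπi.ne_zero] at hP
    have : (0 : ℤ) ≤ π₀.natDegree := by positivity
    nlinarith
  refine ⟨?_, htO, hD⟩
  -- the homogenised pull-back `Ñ` of `π₀` under `A/B`, `A = (X³ + 1)²`, `B = (X³ - 1)²`
  set A : K[X] := (X ^ 3 + 1) ^ 2 with hA
  set B : K[X] := (X ^ 3 - 1) ^ 2 with hB
  set N : K[X] := ∑ i ∈ Finset.range (π₀.natDegree + 1),
    C (π₀.coeff i) * A ^ i * B ^ (π₀.natDegree - i) with hN
  obtain ⟨-, hD0, -, -⟩ := seed_ne_zero (K := K)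
  have haB : aeval (RatFunc.X : RatFunc K) B = (RatFunc.X ^ 3 - 1) ^ 2 := by simp [hB]
  have haB0 : aeval (RatFunc.X : RatFunc K) B ≠ 0 := by rw [haB]; exact pow_ne_zero _ hD0
  have hNf : aeval (RatFunc.X : RatFunc K) N = aeval (RatFunc.X : RatFunc K) B ^ π₀.natDegree *
      aeval 𝔣(K) π₀ := by
    rw [hN, aeval_pullback_eq π₀ A B haB0, ← seed_eq_aeval_div]
  have hπf0 : aeval 𝔣(K) π₀ ≠ 0 := aeval_seed_ne_zero hπi.ne_zero
  have hN0 : N ≠ 0 := by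
    intro h
    rw [h, map_zero] at hNf
    exact mul_ne_zero (pow_ne_zero _ haB0) hπf0 hNf.symm
  -- `A`, `B` are coprime and the Wronskian is `-12 X² (X³ + 1)(X³ - 1)`
  have h2 : (2 : K) ≠ 0 := two_ne_zero
  have hcop : IsCoprime A B := by
    have hbase : IsCoprime (X ^ 3 + 1 : K[X]) (X ^ 3 - 1) := by
      refine ⟨C (2⁻¹ : K), -C (2⁻¹ : K), ?_⟩
      have h : C (2⁻¹ : K) * (X ^ 3 + 1 : K[X]) + -C (2⁻¹ : K) * (X ^ 3 - 1) = C (2⁻¹ : K) * C 2 := by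
        rw [map_ofNat]; ring
      rw [h, ← map_mul, inv_mul_cancel₀ h2, map_one]
    exact hbase.pow
  have hWeq : derivative A * B - A * derivative B = C (-12 : K) * X ^ 2 * (X ^ 3 + 1) * (X ^ 3 - 1) := by
    simp only [hA, hB, derivative_sq, derivative_add, derivative_sub, derivative_X_pow, derivative_one,
      Nat.cast_ofNat, add_zero, sub_zero, map_neg, map_ofNat, Nat.add_one_sub_one]
    ring
  have hW : ∀ ρ : K[X], Irreducible ρ → ρ ∣ derivative A * B - A * derivative B →
      ρ ∣ A ∨ ρ ∣ B ∨ ρ ∣ A - B := by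
    intro ρ hρ hdvd
    rw [hWeq] at hdvd
    have hp := hρ.prime
    rcases hp.dvd_or_dvd hdvd with h | h
    · rcases hp.dvd_or_dvd h with h | h
      · rcases hp.dvd_or_dvd h with h | h
        · exact (hρ.not_isUnit (isUnit_of_dvd_unit h (isUnit_C.mpr (by norm_num)))).elim
        · right; right
          have hAB : A - B = C (4 : K) * X ^ 3 := by rw [hA, hB, map_ofNat C 4]; ring
          rw [hAB]
          exact dvd_mul_of_dvd_right ((hp.dvd_of_dvd_pow h).trans (dvd_pow_self X three_ne_zero)) _
      · left; rw [hA]; exact h.trans (dvd_pow_self _ two_ne_zero)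
    · right; left; rw [hB]; exact h.trans (dvd_pow_self _ two_ne_zero)
  have hsep : N.Separable := pullback_separable hπi hπm hπX hπX1 hcop hW hN0
  -- `v_P(Ñ(t)) = v_P(π₀(𝔣)) = 1`
  have hordB : P.ord (aeval (RatFunc.X : RatFunc K) B) = 0 := by rw [haB, P.ord_pow hD0, hD, mul_zero]
  have hordN : P.ord (aeval (RatFunc.X : RatFunc K) N) = P.ord (aeval 𝔣(K) π₀) := by
    rw [hNf, P.ord_mul_eq (pow_ne_zero _ haB0) hπf0, P.ord_pow haB0, hordB, mul_zero, zero_add]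
  have h := P.ord_aeval_eq_one_of_separable_of_finrank_eq_one hut hu1 hsep (by rw [hordN]; exact hP)
  rwa [hordN] at h

omit [CharZero K] in
/-- `v_P(t - c) ∈ {0, 1}` at a place with `t ∈ 𝒪_P`, and it is `1` iff the residue of `t` is `c`.
[folklore] -/
theorem line_ord_X_sub_C_cases (P : PlaceOver K (RatFunc K))
    (htO : (RatFunc.X : RatFunc K) ∈ P.toValuationSubring) (c : K) :
    (P.ord (aeval (RatFunc.X : RatFunc K) (X - C c : K[X])) = 0 ∧
        IsLocalRing.residue P.toValuationSubring ⟨RatFunc.X, htO⟩ ≠ algebraMap K _ c) ∨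
      (P.ord (aeval (RatFunc.X : RatFunc K) (X - C c : K[X])) = 1 ∧
        IsLocalRing.residue P.toValuationSubring ⟨RatFunc.X, htO⟩ = algebraMap K _ c) := by
  have hut := RatFunc.transcendental_X (K := K)
  have hu1 := finrank_adjoin_ratFunc_X (K := K)
  have hc0 : aeval (RatFunc.X : RatFunc K) (X - C c : K[X]) ≠ 0 :=
    aeval_ratFunc_X_ne_zero (X_sub_C_ne_zero c)
  have hiff : 0 < P.ord (aeval (RatFunc.X : RatFunc K) (X - C c : K[X])) ↔
      IsLocalRing.residue P.toValuationSubring ⟨RatFunc.X, htO⟩ = algebraMap K _ c := by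
    rw [P.ord_aeval_pos_iff htO hc0, map_sub, aeval_X, aeval_C, sub_eq_zero]
  have hnn := P.ord_nonneg_of_mem (P.aeval_mem htO (X - C c))
  rcases hnn.lt_or_eq with hpos | hzero
  · right
    exact ⟨P.ord_aeval_eq_one_of_separable_of_finrank_eq_one hut hu1 (separable_X_sub_C (x := c))
      hpos, hiff.1 hpos⟩
  · left
    refine ⟨hzero.symm, fun h => ?_⟩
    have := hiff.2 h
    omega

/-- **The radicands at the poles of the seed.** At a place `P` with `t ∈ 𝒪_P` above `t³ = 1` the
residue `r` of `t` is `1`, `ζ` or `ζ²`, and accordingly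
`(v_P((t-1)(t-ζ)^b), v_P((t-1)(t-ζ²)^b)) = (1, 1)`, `(b, 0)` or `(0, b)`. [folklore] -/
theorem seed_pole_radicands {ζ : K} (hζ : ζ ^ 2 + ζ + 1 = 0) (b : ℕ) (P : PlaceOver K (RatFunc K))
    (htO : (RatFunc.X : RatFunc K) ∈ P.toValuationSubring)
    (hD : 0 < P.ord ((RatFunc.X : RatFunc K) ^ 3 - 1)) :
    (P.ord 𝔥(K, ζ, b) = 1 ∧ P.ord 𝔥(K, ζ ^ 2, b) = 1) ∨
      (P.ord 𝔥(K, ζ, b) = b ∧ P.ord 𝔥(K, ζ ^ 2, b) = 0) ∨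
      (P.ord 𝔥(K, ζ, b) = 0 ∧ P.ord 𝔥(K, ζ ^ 2, b) = b) := by
  have hζ1 := cubeRoot_ne_one hζ
  have hζ21 := cubeRoot_ne_one (cubeRoot_sq hζ)
  have hζ2 := cubeRoot_sq_ne_self hζ
  obtain ⟨-, hD0, -, -⟩ := seed_ne_zero (K := K)
  have hinj := (algebraMap K P.residueField).injective
  -- `r³ = 1` for the residue `r` of `t`
  have hr3 : IsLocalRing.residue P.toValuationSubring ⟨RatFunc.X, htO⟩ ^ 3 = 1 := by
    have hD' : 0 < P.ord (aeval (RatFunc.X : RatFunc K) (X ^ 3 - 1 : K[X])) := by simpa using hD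
    rw [P.ord_aeval_pos_iff htO (by simpa using hD0)] at hD'
    simpa [sub_eq_zero] using hD'
  -- valuations of the linear factors
  have hne : ∀ c : K, aeval (RatFunc.X : RatFunc K) (X - C c : K[X]) ≠ 0 := fun c =>
    aeval_ratFunc_X_ne_zero (X_sub_C_ne_zero c)
  have hsplit : ∀ c : K, P.ord 𝔥(K, c, b) = P.ord (aeval (RatFunc.X : RatFunc K) (X - C 1 : K[X])) +
      b * P.ord (aeval (RatFunc.X : RatFunc K) (X - C c : K[X])) := fun c => by
    rw [map_mul, map_pow, P.ord_mul_eq (hne 1) (pow_ne_zero _ (hne c)), P.ord_pow (hne c)]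
  rw [hsplit ζ, hsplit (ζ ^ 2)]
  rcases eq_of_pow_three_eq_one hζ hr3 with h1 | hz | hz2
  · -- `r = 1`
    left
    have v1 : P.ord (aeval (RatFunc.X : RatFunc K) (X - C 1 : K[X])) = 1 := by
      rcases line_ord_X_sub_C_cases P htO 1 with ⟨-, h⟩ | ⟨h, -⟩
      · exact absurd (by rw [map_one]; exact h1) h
      · exact h
    have vz : P.ord (aeval (RatFunc.X : RatFunc K) (X - C ζ : K[X])) = 0 := by
      rcases line_ord_X_sub_C_cases P htO ζ with ⟨h, -⟩ | ⟨-, h⟩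
      · exact h
      · exact absurd (hinj (by rw [← h, h1, map_one])) hζ1
    have vz2 : P.ord (aeval (RatFunc.X : RatFunc K) (X - C (ζ ^ 2) : K[X])) = 0 := by
      rcases line_ord_X_sub_C_cases P htO (ζ ^ 2) with ⟨h, -⟩ | ⟨-, h⟩
      · exact h
      · exact absurd (hinj (by rw [← h, h1, map_one])) hζ21
    rw [v1, vz, vz2]; simp
  · -- `r = ζ`
    right; left
    have v1 : P.ord (aeval (RatFunc.X : RatFunc K) (X - C 1 : K[X])) = 0 := by
      rcases line_ord_X_sub_C_cases P htO 1 with ⟨h, -⟩ | ⟨-, h⟩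
      · exact h
      · exact absurd (hinj (by rw [← hz]; exact h)) hζ1
    have vz : P.ord (aeval (RatFunc.X : RatFunc K) (X - C ζ : K[X])) = 1 := by
      rcases line_ord_X_sub_C_cases P htO ζ with ⟨-, h⟩ | ⟨h, -⟩
      · exact absurd hz h
      · exact h
    have vz2 : P.ord (aeval (RatFunc.X : RatFunc K) (X - C (ζ ^ 2) : K[X])) = 0 := by
      rcases line_ord_X_sub_C_cases P htO (ζ ^ 2) with ⟨h, -⟩ | ⟨-, h⟩
      · exact h
      · exact absurd (hinj (by rw [← h]; exact hz)) hζ2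
    rw [v1, vz, vz2]; simp
  · -- `r = ζ²`
    right; right
    have v1 : P.ord (aeval (RatFunc.X : RatFunc K) (X - C 1 : K[X])) = 0 := by
      rcases line_ord_X_sub_C_cases P htO 1 with ⟨h, -⟩ | ⟨-, h⟩
      · exact h
      · exact absurd (hinj (by rw [← hz2]; exact h)) hζ21
    have vz : P.ord (aeval (RatFunc.X : RatFunc K) (X - C ζ : K[X])) = 0 := by
      rcases line_ord_X_sub_C_cases P htO ζ with ⟨h, -⟩ | ⟨-, h⟩
      · exact h
      · exact absurd (hinj (by rw [← hz2]; exact h)) hζ2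
    have vz2 : P.ord (aeval (RatFunc.X : RatFunc K) (X - C (ζ ^ 2) : K[X])) = 1 := by
      rcases line_ord_X_sub_C_cases P htO (ζ ^ 2) with ⟨-, h⟩ | ⟨h, -⟩
      · exact absurd hz2 h
      · exact h
    rw [v1, vz, vz2]; simp

end Seed

/-! ### D. Poles through a mixed layer -/

namespace PlaceOver

variable {K : Type u} {F : Type v} {F' : Type v} [Field K] [Field F] [Algebra K F]
variable [Field F'] [Algebra F F'] [Algebra K F'] [IsScalarTower K F F']
variable [IsAlgFunctionField K F] [IsAlgFunctionField K F'] [FiniteDimensional F F']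
  [Algebra.IsSeparable F F']

/-- **Poles, mixed layer.** If at every pole `P` of `s ∈ F` either `v_P(s) = p₀` and `q ∣ v_P(h)`, or
`q v_P(s) = p₀` and `v_P(h)` is prime to `q`, then every pole `Q` of `s` in `F' = F(h^{1/q})` has
`v_Q(s) = p₀` (the twin of `ord_algebraMap_eq_of_forall_ord_pos_mixed`).
[cite: Stichtenoth2009, Prop. 3.7.3(b)] -/
theorem ord_algebraMap_eq_of_forall_ord_neg_mixed {q : ℕ} (hq : 0 < q) (hqK : (q : K) ≠ 0)
    {h : F} (hh0 : h ≠ 0) {g : F'} (hg : g ^ q = algebraMap F F' h) (hgen : F⟮g⟯ = ⊤)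
    {s : F} {p₀ : ℤ}
    (hs : ∀ P : PlaceOver K F, P.ord s < 0 →
      (P.ord s = p₀ ∧ (q : ℤ) ∣ P.ord h) ∨ ((q : ℤ) * P.ord s = p₀ ∧ IsCoprime (P.ord h) (q : ℤ)))
    (Q : PlaceOver K F') (hQ : Q.ord (algebraMap F F' s) < 0) : Q.ord (algebraMap F F' s) = p₀ := by
  have hmul := Q.ord_algebraMap_eq_mul (K := K) (F := F) s
  have he1 := Q.one_le_ord_algebraMap_uniformizer (K := K) (F := F)
  have hPs : (Q.restrict (K := K) (F := F)).ord s < 0 := by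
    by_contra hle
    have : 0 ≤ Q.ord (algebraMap F F' ((Q.restrict (K := K) (F := F)).uniformizer : F)) *
        (Q.restrict (K := K) (F := F)).ord s :=
      mul_nonneg (by omega) (not_lt.1 hle)
    omega
  rcases hs _ hPs with ⟨hp₀, hdvd⟩ | ⟨hp₀, hcop⟩
  · have he := (Q.restrict (K := K) (F := F)).ord_algebraMap_uniformizer_eq_one_of_pow_eq_of_dvd
      hq hqK hh0 hdvd hg hgen Q rfl
    rw [hmul, he, one_mul, hp₀]
  · obtain ⟨he, -⟩ :=
      (Q.restrict (K := K) (F := F)).ord_algebraMap_uniformizer_eq_of_pow_eq_of_isCoprime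
        hq hh0 hcop hg hgen Q rfl
    rw [hmul, he, hp₀]

end PlaceOver

/-! ### E. After the first Kummer layer `F₃ = K(t)(g₃)`, `g₃^m = (t - 1)(t - ζ)^{m-1}` -/

section Layer3

variable {K : Type u} [Field K] [CharZero K]
variable {F₃ : Type u} [Field F₃] [Algebra (RatFunc K) F₃] [Algebra K F₃]
  [IsScalarTower K (RatFunc K) F₃] [FiniteDimensional (RatFunc K) F₃]
  [Algebra.IsSeparable (RatFunc K) F₃]

omit [CharZero K] in
/-- `m - 1` is prime to `m` (as integers, `m ≥ 1`). [folklore] -/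
theorem isCoprime_pred_self {m : ℕ} (hm : 0 < m) : IsCoprime ((m - 1 : ℕ) : ℤ) (m : ℤ) := by
  have h1 : ((m - 1 : ℕ) : ℤ) = m - 1 := by rw [Nat.cast_sub hm]; simp
  rw [h1]; exact ⟨-1, 1, by ring⟩

/-- **Layer 3, zeros of the seed**: `v_Q(𝔣) = 2` and `m ∣ v_Q(h₄)` (`h₃`, `h₄` are units below `Q`).
[cite: Stichtenoth2009, Prop. 3.7.3] -/
theorem layer3_zeros {m : ℕ} (hm : 0 < m) {ζ : K} (hζ : ζ ^ 2 + ζ + 1 = 0) {g₃ : F₃}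
    (hg₃ : g₃ ^ m = algebraMap (RatFunc K) F₃ 𝔥(K, ζ, m - 1))
    (hgen₃ : IntermediateField.adjoin (RatFunc K) {g₃} = ⊤) (Q : PlaceOver K F₃)
    (hQ : 0 < Q.ord (algebraMap (RatFunc K) F₃ 𝔣(K))) :
    Q.ord (algebraMap (RatFunc K) F₃ 𝔣(K)) = 2 ∧
      (m : ℤ) ∣ Q.ord (algebraMap (RatFunc K) F₃ 𝔥(K, ζ ^ 2, m - 1)) := by
  haveI : IsAlgFunctionField K F₃ := isAlgFunctionField_of_finiteDimensional (K := K) (F := RatFunc K)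
  have hmK : (m : K) ≠ 0 := Nat.cast_ne_zero.2 hm.ne'
  have h3 := cubeRoot_pow_three hζ
  have h3' := cubeRoot_pow_three (cubeRoot_sq hζ)
  set P := Q.restrict (K := K) (F := RatFunc K) with hP
  have hmul := Q.ord_algebraMap_eq_mul (K := K) (F := RatFunc K) 𝔣(K)
  have hmul₄ := Q.ord_algebraMap_eq_mul (K := K) (F := RatFunc K) 𝔥(K, ζ ^ 2, m - 1)
  have he1 := Q.one_le_ord_algebraMap_uniformizer (K := K) (F := RatFunc K)
  rw [← hP] at hmul hmul₄ he1
  have hPs : 0 < P.ord 𝔣(K) := by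
    by_contra hle
    have : Q.ord (algebraMap (RatFunc K) F₃ (P.uniformizer : RatFunc K)) * P.ord 𝔣(K) ≤ 0 :=
      mul_nonpos_of_nonneg_of_nonpos (by omega) (not_lt.1 hle)
    omega
  obtain ⟨htO, hD, hf⟩ : (RatFunc.X : RatFunc K) ∈ P.toValuationSubring ∧
      P.ord ((RatFunc.X : RatFunc K) ^ 3 - 1) = 0 ∧ P.ord 𝔣(K) = 2 := by
    rcases seed_cases P with ⟨-, hf, -⟩ | ⟨-, hf, -⟩ | ⟨htO, hD, hf, -⟩ | ⟨-, -, hf, -⟩ |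
      ⟨-, -, -, -, hf, -⟩
    · omega
    · omega
    · exact ⟨htO, hD, hf⟩
    · omega
    · omega
  have hh₃ : P.ord 𝔥(K, ζ, m - 1) = 0 := twoLayer_ord_h₁_eq_zero (by norm_num) (m - 1) h3 P htO hD
  have hh₄ : P.ord 𝔥(K, ζ ^ 2, m - 1) = 0 := twoLayer_ord_h₁_eq_zero (by norm_num) (m - 1) h3' P htO hD
  have he : Q.ord (algebraMap (RatFunc K) F₃ (P.uniformizer : RatFunc K)) = 1 :=
    P.ord_algebraMap_uniformizer_eq_one_of_pow_eq_of_dvd hm hmK (twoLayer_h₁_ne_zero (m - 1) ζ)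
      (by rw [hh₃]; exact dvd_zero _) hg₃ hgen₃ Q hP.symm
  refine ⟨by rw [hmul, he, one_mul, hf], ?_⟩
  rw [hmul₄, he, one_mul, hh₄]
  exact dvd_zero _

/-- **Layer 3, zeros of `𝔣 - 1`** (above `t = ∞` and `t = 0`): `v_Q(𝔣 - 1) = 3` and `m ∣ v_Q(h₄)`
(`v(h₃) = v(h₄) = -m` at `t = ∞`, `= 0` at `t = 0`). [cite: Stichtenoth2009, Prop. 3.7.3] -/
theorem layer3_ones {m : ℕ} (hm : 0 < m) {ζ : K} (hζ : ζ ^ 2 + ζ + 1 = 0) {g₃ : F₃}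
    (hg₃ : g₃ ^ m = algebraMap (RatFunc K) F₃ 𝔥(K, ζ, m - 1))
    (hgen₃ : IntermediateField.adjoin (RatFunc K) {g₃} = ⊤) (Q : PlaceOver K F₃)
    (hQ : 0 < Q.ord (algebraMap (RatFunc K) F₃ (𝔣(K) - 1))) :
    Q.ord (algebraMap (RatFunc K) F₃ (𝔣(K) - 1)) = 3 ∧
      (m : ℤ) ∣ Q.ord (algebraMap (RatFunc K) F₃ 𝔥(K, ζ ^ 2, m - 1)) := by
  haveI : IsAlgFunctionField K F₃ := isAlgFunctionField_of_finiteDimensional (K := K) (F := RatFunc K)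
  have hmK : (m : K) ≠ 0 := Nat.cast_ne_zero.2 hm.ne'
  have h3 := cubeRoot_pow_three hζ
  have h3' := cubeRoot_pow_three (cubeRoot_sq hζ)
  have hm1 : ((1 + (m - 1 : ℕ) : ℤ)) = m := by rw [Nat.cast_sub hm]; ring
  set P := Q.restrict (K := K) (F := RatFunc K) with hP
  have hmul := Q.ord_algebraMap_eq_mul (K := K) (F := RatFunc K) (𝔣(K) - 1)
  have hmul₄ := Q.ord_algebraMap_eq_mul (K := K) (F := RatFunc K) 𝔥(K, ζ ^ 2, m - 1)
  have he1 := Q.one_le_ord_algebraMap_uniformizer (K := K) (F := RatFunc K)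
  rw [← hP] at hmul hmul₄ he1
  have hPs : 0 < P.ord (𝔣(K) - 1) := by
    by_contra hle
    have : Q.ord (algebraMap (RatFunc K) F₃ (P.uniformizer : RatFunc K)) * P.ord (𝔣(K) - 1) ≤ 0 :=
      mul_nonpos_of_nonneg_of_nonpos (by omega) (not_lt.1 hle)
    omega
  -- above `t = ∞` or `t = 0`
  have hcase : (P.ord (RatFunc.X : RatFunc K) < 0 ∨ 0 < P.ord (RatFunc.X : RatFunc K)) ∧
      P.ord (𝔣(K) - 1) = 3 := by
    rcases seed_cases P with ⟨hneg, -, hf1, -⟩ | ⟨hpos, -, hf1, -⟩ | ⟨-, -, -, hf1, -⟩ |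
      ⟨-, -, -, hf1, -⟩ | ⟨-, -, -, -, -, hf1⟩
    · exact ⟨Or.inl hneg, hf1⟩
    · exact ⟨Or.inr hpos, hf1⟩
    · omega
    · omega
    · omega
  obtain ⟨ht, hf1⟩ := hcase
  have hh : (P.ord 𝔥(K, ζ, m - 1) = -m ∧ P.ord 𝔥(K, ζ ^ 2, m - 1) = -m) ∨
      (P.ord 𝔥(K, ζ, m - 1) = 0 ∧ P.ord 𝔥(K, ζ ^ 2, m - 1) = 0) := by
    rcases ht with hneg | hpos
    · left
      rw [twoLayer_ord_h₁_of_pole (m - 1) ζ P hneg, twoLayer_ord_h₁_of_pole (m - 1) (ζ ^ 2) P hneg, hm1]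
      exact ⟨rfl, rfl⟩
    · right
      exact ⟨twoLayer_ord_h₁_of_zero (by norm_num) (m - 1) h3 P hpos,
        twoLayer_ord_h₁_of_zero (by norm_num) (m - 1) h3' P hpos⟩
  have hdvd₃ : (m : ℤ) ∣ P.ord 𝔥(K, ζ, m - 1) := by
    rcases hh with ⟨h, -⟩ | ⟨h, -⟩
    · rw [h]; exact ⟨-1, by ring⟩
    · rw [h]; exact dvd_zero _
  have hdvd₄ : (m : ℤ) ∣ P.ord 𝔥(K, ζ ^ 2, m - 1) := by
    rcases hh with ⟨-, h⟩ | ⟨-, h⟩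
    · rw [h]; exact ⟨-1, by ring⟩
    · rw [h]; exact dvd_zero _
  have he : Q.ord (algebraMap (RatFunc K) F₃ (P.uniformizer : RatFunc K)) = 1 :=
    P.ord_algebraMap_uniformizer_eq_one_of_pow_eq_of_dvd hm hmK (twoLayer_h₁_ne_zero (m - 1) ζ)
      hdvd₃ hg₃ hgen₃ Q hP.symm
  refine ⟨by rw [hmul, he, one_mul, hf1], ?_⟩
  rw [hmul₄, he, one_mul]
  exact hdvd₄

/-- **Layer 3, poles of the seed**: above a place of the line with residue `t = 1` or `t = ζ` the
layer is totally ramified (`v(h₃) = 1`, resp. `m - 1`, prime to `m`), so `v_Q(𝔣) = -2m` and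
`m ∣ v_Q(h₄)`; above `t = ζ²` it is unramified (`v(h₃) = 0`), so `v_Q(𝔣) = -2` and
`v_Q(h₄) = m - 1` is prime to `m`. [cite: Stichtenoth2009, Prop. 3.7.3] -/
theorem layer3_poles {m : ℕ} (hm : 0 < m) {ζ : K} (hζ : ζ ^ 2 + ζ + 1 = 0) {g₃ : F₃}
    (hg₃ : g₃ ^ m = algebraMap (RatFunc K) F₃ 𝔥(K, ζ, m - 1))
    (hgen₃ : IntermediateField.adjoin (RatFunc K) {g₃} = ⊤) (Q : PlaceOver K F₃)
    (hQ : Q.ord (algebraMap (RatFunc K) F₃ 𝔣(K)) < 0) :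
    (Q.ord (algebraMap (RatFunc K) F₃ 𝔣(K)) = -(2 * (m : ℤ)) ∧
        (m : ℤ) ∣ Q.ord (algebraMap (RatFunc K) F₃ 𝔥(K, ζ ^ 2, m - 1))) ∨
      ((m : ℤ) * Q.ord (algebraMap (RatFunc K) F₃ 𝔣(K)) = -(2 * (m : ℤ)) ∧
        IsCoprime (Q.ord (algebraMap (RatFunc K) F₃ 𝔥(K, ζ ^ 2, m - 1))) (m : ℤ)) := by
  haveI : IsAlgFunctionField K F₃ := isAlgFunctionField_of_finiteDimensional (K := K) (F := RatFunc K)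
  have hmK : (m : K) ≠ 0 := Nat.cast_ne_zero.2 hm.ne'
  have hne₃ := twoLayer_h₁_ne_zero (K := K) (m - 1) ζ
  set P := Q.restrict (K := K) (F := RatFunc K) with hP
  have hmul := Q.ord_algebraMap_eq_mul (K := K) (F := RatFunc K) 𝔣(K)
  have hmul₄ := Q.ord_algebraMap_eq_mul (K := K) (F := RatFunc K) 𝔥(K, ζ ^ 2, m - 1)
  have he1 := Q.one_le_ord_algebraMap_uniformizer (K := K) (F := RatFunc K)
  rw [← hP] at hmul hmul₄ he1
  have hPs : P.ord 𝔣(K) < 0 := by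
    by_contra hle
    have : 0 ≤ Q.ord (algebraMap (RatFunc K) F₃ (P.uniformizer : RatFunc K)) * P.ord 𝔣(K) :=
      mul_nonneg (by omega) (not_lt.1 hle)
    omega
  obtain ⟨htO, hD, hf⟩ : (RatFunc.X : RatFunc K) ∈ P.toValuationSubring ∧
      P.ord ((RatFunc.X : RatFunc K) ^ 3 - 1) = 1 ∧ P.ord 𝔣(K) = -2 := by
    rcases seed_cases P with ⟨-, hf, -⟩ | ⟨-, hf, -⟩ | ⟨-, -, hf, -⟩ | ⟨htO, hD, hf, -⟩ |
      ⟨-, -, -, -, hf, -⟩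
    · omega
    · omega
    · omega
    · exact ⟨htO, hD, hf⟩
    · omega
  rcases seed_pole_radicands hζ (m - 1) P htO (by rw [hD]; exact one_pos) with
    ⟨hh₃, hh₄⟩ | ⟨hh₃, hh₄⟩ | ⟨hh₃, hh₄⟩
  · -- residue `t = 1`: totally ramified, `v(h₄) = 1` downstairs
    left
    obtain ⟨he, -⟩ := P.ord_algebraMap_uniformizer_eq_of_pow_eq_of_isCoprime hm hne₃
      (by rw [hh₃]; exact isCoprime_one_left) hg₃ hgen₃ Q hP.symm
    refine ⟨by rw [hmul, he, hf]; ring, ?_⟩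
    rw [hmul₄, he, hh₄]
    exact dvd_mul_right _ _
  · -- residue `t = ζ`: totally ramified, `v(h₄) = 0` downstairs
    left
    obtain ⟨he, -⟩ := P.ord_algebraMap_uniformizer_eq_of_pow_eq_of_isCoprime hm hne₃
      (by rw [hh₃]; exact isCoprime_pred_self hm) hg₃ hgen₃ Q hP.symm
    refine ⟨by rw [hmul, he, hf]; ring, ?_⟩
    rw [hmul₄, he, hh₄, mul_zero]
    exact dvd_zero _
  · -- residue `t = ζ²`: unramified, `v(h₄) = m - 1`
    right
    have he : Q.ord (algebraMap (RatFunc K) F₃ (P.uniformizer : RatFunc K)) = 1 :=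
      P.ord_algebraMap_uniformizer_eq_one_of_pow_eq_of_dvd hm hmK hne₃
        (by rw [hh₃]; exact dvd_zero _) hg₃ hgen₃ Q hP.symm
    refine ⟨by rw [hmul, he, hf]; ring, ?_⟩
    rw [hmul₄, he, one_mul, hh₄]
    exact isCoprime_pred_self hm

/-- **Layer 3, the other closed points**: for `π₀` monic irreducible, `π₀ ∉ {X, X - 1}`:
`v_Q(π₀(𝔣)) = 1` at its zeros and `m ∣ v_Q(h₄)` (`= 0`). [cite: Stichtenoth2009, Prop. 3.7.3] -/
theorem layer3_elsewhere {m : ℕ} (hm : 0 < m) {ζ : K} (hζ : ζ ^ 2 + ζ + 1 = 0) {g₃ : F₃}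
    (hg₃ : g₃ ^ m = algebraMap (RatFunc K) F₃ 𝔥(K, ζ, m - 1))
    (hgen₃ : IntermediateField.adjoin (RatFunc K) {g₃} = ⊤) {π₀ : K[X]} (hπi : Irreducible π₀)
    (hπm : π₀.Monic) (hπX : π₀ ≠ X) (hπX1 : π₀ ≠ X - 1) (Q : PlaceOver K F₃)
    (hQ : 0 < Q.ord (algebraMap (RatFunc K) F₃ (aeval 𝔣(K) π₀))) :
    Q.ord (algebraMap (RatFunc K) F₃ (aeval 𝔣(K) π₀)) = 1 ∧
      (m : ℤ) ∣ Q.ord (algebraMap (RatFunc K) F₃ 𝔥(K, ζ ^ 2, m - 1)) := by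
  haveI : IsAlgFunctionField K F₃ := isAlgFunctionField_of_finiteDimensional (K := K) (F := RatFunc K)
  have hmK : (m : K) ≠ 0 := Nat.cast_ne_zero.2 hm.ne'
  have h3 := cubeRoot_pow_three hζ
  have h3' := cubeRoot_pow_three (cubeRoot_sq hζ)
  set P := Q.restrict (K := K) (F := RatFunc K) with hP
  have hmul := Q.ord_algebraMap_eq_mul (K := K) (F := RatFunc K) (aeval 𝔣(K) π₀)
  have hmul₄ := Q.ord_algebraMap_eq_mul (K := K) (F := RatFunc K) 𝔥(K, ζ ^ 2, m - 1)
  have he1 := Q.one_le_ord_algebraMap_uniformizer (K := K) (F := RatFunc K)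
  rw [← hP] at hmul hmul₄ he1
  have hPs : 0 < P.ord (aeval 𝔣(K) π₀) := by
    by_contra hle
    have : Q.ord (algebraMap (RatFunc K) F₃ (P.uniformizer : RatFunc K)) * P.ord (aeval 𝔣(K) π₀) ≤ 0 :=
      mul_nonpos_of_nonneg_of_nonpos (by omega) (not_lt.1 hle)
    omega
  obtain ⟨hone, htO, hD⟩ := seed_elsewhere hπi hπm hπX hπX1 P hPs
  have hh₃ : P.ord 𝔥(K, ζ, m - 1) = 0 := twoLayer_ord_h₁_eq_zero (by norm_num) (m - 1) h3 P htO hD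
  have hh₄ : P.ord 𝔥(K, ζ ^ 2, m - 1) = 0 := twoLayer_ord_h₁_eq_zero (by norm_num) (m - 1) h3' P htO hD
  have he : Q.ord (algebraMap (RatFunc K) F₃ (P.uniformizer : RatFunc K)) = 1 :=
    P.ord_algebraMap_uniformizer_eq_one_of_pow_eq_of_dvd hm hmK (twoLayer_h₁_ne_zero (m - 1) ζ)
      (by rw [hh₃]; exact dvd_zero _) hg₃ hgen₃ Q hP.symm
  refine ⟨by rw [hmul, he, one_mul, hone], ?_⟩
  rw [hmul₄, he, one_mul, hh₄]
  exact dvd_zero _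

end Layer3

/-! ### F. The second Kummer layer and the covering of signature `(2, 3, 2m)` -/

section Cover

/-- **Two Kummer layers over the seed: a covering of signature `(2, 3, 2m)`** over (the full constant
field inside `F₄` of) any number field `K` containing a primitive cube root of unity `ζ`:
`F₄ = K(t)(g₃)(g₄)`, `g₃^m = (t - 1)(t - ζ)^{m-1}`, `g₄^m = (t - 1)(t - ζ²)^{m-1}`, and
`f = ((t³ + 1)/(t³ - 1))²`. [cite: Stichtenoth2009, Prop. 3.7.3]
[cite: DarmonGranville1995, Prop. 3.1 (p. 525), signature `(2, 3, 2m)`] -/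
theorem exists_belyiMap_signature_two_three_even_aux (K : Type u) [Field K] [NumberField K]
    {m : ℕ} (hm : 0 < m) {ζ : K} (hζ : ζ ^ 2 + ζ + 1 = 0) :
    ∃ (K' : Type u) (_ : Field K') (_ : NumberField K') (F : Type u) (_ : Field F) (_ : Algebra K' F)
      (_ : IsAlgFunctionField K' F) (_ : IsIntegrallyClosedIn K' F) (f : F),
      f ∉ Set.range (algebraMap K' F) ∧
      (∀ P : PlaceOver K' F, 0 < P.ord f → P.ord f = 2) ∧
      (∀ P : PlaceOver K' F, 0 < P.ord (f - 1) → P.ord (f - 1) = 3) ∧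
      (∀ P : PlaceOver K' F, P.ord f < 0 → P.ord f = -((2 * m : ℕ) : ℤ)) ∧
      (∀ π₀ : K'[X], Irreducible π₀ → π₀.Monic → π₀ ≠ X → π₀ ≠ X - 1 →
        ∀ P : PlaceOver K' F, 0 < P.ord (aeval f π₀) → P.ord (aeval f π₀) = 1) := by
  haveI : CharZero (RatFunc K) :=
    charZero_of_injective_algebraMap (algebraMap K (RatFunc K)).injective
  have hmK : (m : K) ≠ 0 := Nat.cast_ne_zero.2 hm.ne'
  -- layer 3
  obtain ⟨F₃, _, _, _, _, _, _, g₃, hg₃, hgen₃⟩ := exists_radical_extension (K := K) (F := RatFunc K)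
    𝔥(K, ζ, m - 1) hm
  haveI hAF₃ : IsAlgFunctionField K F₃ :=
    isAlgFunctionField_of_finiteDimensional (K := K) (F := RatFunc K)
  haveI : CharZero F₃ := charZero_of_injective_algebraMap (algebraMap K F₃).injective
  -- layer 4
  have hH₄0 : algebraMap (RatFunc K) F₃ 𝔥(K, ζ ^ 2, m - 1) ≠ 0 :=
    (_root_.map_ne_zero _).2 (twoLayer_h₁_ne_zero (m - 1) (ζ ^ 2))
  obtain ⟨F₄, _, _, _, _, _, _, g₄, hg₄, hgen₄⟩ := exists_radical_extension (K := K) (F := F₃)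
    (algebraMap (RatFunc K) F₃ 𝔥(K, ζ ^ 2, m - 1)) hm
  haveI hAF₄ : IsAlgFunctionField K F₄ := isAlgFunctionField_of_finiteDimensional (K := K) (F := F₃)
  -- the function `f = 𝔣`
  set S : F₃ := algebraMap (RatFunc K) F₃ 𝔣(K) with hS
  set f : F₄ := algebraMap F₃ F₄ S with hf
  have hSt : Transcendental K S :=
    (transcendental_algebraMap_iff (algebraMap (RatFunc K) F₃).injective).2 seed_transcendental
  have hft : Transcendental K f := (transcendental_algebraMap_iff (algebraMap F₃ F₄).injective).2 hSt
  -- the four clauses over `K`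
  have h₀ : ∀ R : PlaceOver K F₄, 0 < R.ord f → R.ord f = 2 := fun R hR =>
    PlaceOver.ord_algebraMap_eq_of_forall_ord_pos_of_dvd (K := K) (F := F₃) (F' := F₄) hm hmK hH₄0 hg₄
      hgen₄ (fun Q hQ => layer3_zeros hm hζ hg₃ hgen₃ Q hQ) R hR
  have hi : ∀ R : PlaceOver K F₄, R.ord f < 0 → R.ord f = -((2 * m : ℕ) : ℤ) := fun R hR => by
    have h := PlaceOver.ord_algebraMap_eq_of_forall_ord_neg_mixed (K := K) (F := F₃) (F' := F₄) hm hmK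
      hH₄0 hg₄ hgen₄ (fun Q hQ => layer3_poles hm hζ hg₃ hgen₃ Q hQ) R hR
    rw [h]; push_cast; ring
  have h₁ : ∀ R : PlaceOver K F₄, 0 < R.ord (f - 1) → R.ord (f - 1) = 3 := by
    intro R hR
    have heq : f - 1 = algebraMap F₃ F₄ (algebraMap (RatFunc K) F₃ (𝔣(K) - 1)) := by
      rw [hf, hS, map_sub, map_one, map_sub, map_one]
    rw [heq] at hR ⊢
    exact PlaceOver.ord_algebraMap_eq_of_forall_ord_pos_of_dvd (K := K) (F := F₃) (F' := F₄) hm hmK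
      hH₄0 hg₄ hgen₄ (fun Q hQ => layer3_ones hm hζ hg₃ hgen₃ Q hQ) R hR
  have hunr : ∀ π₀ : K[X], Irreducible π₀ → π₀.Monic → π₀ ≠ X → π₀ ≠ X - 1 →
      ∀ R : PlaceOver K F₄, 0 < R.ord (aeval f π₀) → R.ord (aeval f π₀) = 1 := by
    intro π₀ hπi hπm hX hX1 R hR
    have heq : aeval f π₀ = algebraMap F₃ F₄ (algebraMap (RatFunc K) F₃ (aeval 𝔣(K) π₀)) := by
      rw [hf, hS, aeval_algebraMap_apply, aeval_algebraMap_apply]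
    rw [heq] at hR ⊢
    exact PlaceOver.ord_algebraMap_eq_of_forall_ord_pos_of_dvd (K := K) (F := F₃) (F' := F₄) hm hmK
      hH₄0 hg₄ hgen₄ (fun Q hQ => layer3_elsewhere hm hζ hg₃ hgen₃ hπi hπm hX hX1 Q hQ) R hR
  -- pass to the full constant field
  obtain ⟨K', _, _, _, _, _, hfK', h₀', h₁', hi', hunr'⟩ :=
    exists_fullConstantField_of_signature (K := K) (F := F₄) hft h₀ h₁ hi hunr
  exact ⟨K', inferInstance, inferInstance, F₄, inferInstance, inferInstance, inferInstance,
    inferInstance, f, hfK', h₀', h₁', hi', hunr'⟩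

/-- **A covering of signature `(2, 3, 2m)` over a number field, for every `m ≥ 1`**, in the shape of
the covering input of `finite_properSolutions_of_belyiMap_of_faltings`: the construction over the
cyclotomic field `ℚ(ζ₃)` (classically: the Fermat curve of exponent `m` over the `λ`-line over the
`j`-line). [cite: Stichtenoth2009, Prop. 3.7.3]
[cite: DarmonGranville1995, Prop. 3.1 (p. 525), signature `(2, 3, 2m)`] -/
theorem exists_belyiMap_signature_two_three_even {m : ℕ} (hm : 0 < m) :
    ∃ (K : Type) (_ : Field K) (_ : NumberField K) (F : Type) (_ : Field F) (_ : Algebra K F)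
      (_ : IsAlgFunctionField K F) (_ : IsIntegrallyClosedIn K F) (f : F),
      f ∉ Set.range (algebraMap K F) ∧
      (∀ P : PlaceOver K F, 0 < P.ord f → P.ord f = 2) ∧
      (∀ P : PlaceOver K F, 0 < P.ord (f - 1) → P.ord (f - 1) = 3) ∧
      (∀ P : PlaceOver K F, P.ord f < 0 → P.ord f = -((2 * m : ℕ) : ℤ)) ∧
      (∀ π₀ : K[X], Irreducible π₀ → π₀.Monic → π₀ ≠ X → π₀ ≠ X - 1 →
        ∀ P : PlaceOver K F, 0 < P.ord (aeval f π₀) → P.ord (aeval f π₀) = 1) := by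
  haveI : NeZero (3 : ℕ) := ⟨by norm_num⟩
  obtain ⟨ζ, hζ⟩ := @IsCyclotomicExtension.exists_isPrimitiveRoot {3} ℚ (CyclotomicField 3 ℚ) _ _ _
    (CyclotomicField.isCyclotomicExtension 3 ℚ) 3 (Set.mem_singleton 3) (NeZero.ne 3)
  have hζ3 : ζ ^ 3 = 1 := hζ.pow_eq_one
  have hζ1 : ζ ≠ 1 := hζ.ne_one (by norm_num)
  have hζ' : ζ ^ 2 + ζ + 1 = 0 := by
    have h : (ζ - 1) * (ζ ^ 2 + ζ + 1) = 0 := by linear_combination hζ3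
    exact (mul_eq_zero.mp h).resolve_left (sub_ne_zero.mpr hζ1)
  exact exists_belyiMap_signature_two_three_even_aux (CyclotomicField 3 ℚ) hm hζ'

end Cover

end AlgFunctionField

/-! ### G. Darmon–Granville for the signatures `(2, 3, r)`, `r ≥ 8` even, modulo Faltings -/

section DarmonGranville

open AlgFunctionField

/-- **`A x² + B y³ = C z^{2m}` has finitely many proper solutions for `m ≥ 4`, modulo Faltings'
theorem** (`finite_ratPlaces_of_two_le_genus`): the covering `exists_belyiMap_signature_two_three_even`
fed into `finite_properSolutions_of_belyiMap_of_faltings`; `(2, 3, 2m)` is hyperbolic iff `m ≥ 4`.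
No Riemann existence theorem is used. [cite: DarmonGranville1995, Theorem 2 (p. 515)] -/
theorem finite_properSolutions_signature_two_three_even_of_faltings {m : ℕ} (hm : 4 ≤ m)
    (hFaltings : ∀ (K' : Type) [Field K'] (F' : Type) [Field F'] [Algebra K' F'],
      finite_ratPlaces_of_two_le_genus K' F')
    {A B C : ℤ} (hA : A ≠ 0) (hB : B ≠ 0) (hC : C ≠ 0) :
    {t : ℤ × ℤ × ℤ | ({t.1, t.2.1, t.2.2} : Finset ℤ).gcd id = 1 ∧
      A * t.1 ^ 2 + B * t.2.1 ^ 3 = C * t.2.2 ^ (2 * m)}.Finite := by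
  obtain ⟨K, _, _, F, _, _, _, _, f, hf, h₀, h₁, hi, hunr⟩ :=
    exists_belyiMap_signature_two_three_even (m := m) (by omega)
  have hhyp : 3 * (2 * m) + 2 * m * 2 + 2 * 3 < 2 * 3 * (2 * m) := by ring_nf; omega
  exact finite_properSolutions_of_belyiMap_of_faltings hhyp hf h₀ h₁ hi hunr hFaltings hA hB hC

/-- **`A x^r + B y² = C z³` has finitely many proper solutions for every even `r ≥ 8`, modulo
Faltings' theorem only** (the signature `(L, 2, 3)` of Pasten's Lemma 6.10 for even `L`): from the
previous theorem by permuting the signature. [cite: DarmonGranville1995, Theorem 2 (p. 515)] -/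
theorem finite_properSolutions_signature_even_two_three_of_faltings {r : ℕ} (hr : 8 ≤ r) (h2 : 2 ∣ r)
    (hFaltings : ∀ (K' : Type) [Field K'] (F' : Type) [Field F'] [Algebra K' F'],
      finite_ratPlaces_of_two_le_genus K' F')
    {A B C : ℤ} (hA : A ≠ 0) (hB : B ≠ 0) (hC : C ≠ 0) :
    {t : ℤ × ℤ × ℤ | ({t.1, t.2.1, t.2.2} : Finset ℤ).gcd id = 1 ∧
      A * t.1 ^ r + B * t.2.1 ^ 2 = C * t.2.2 ^ 3}.Finite := by
  obtain ⟨m, rfl⟩ := h2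
  have h23 : ∀ A B C : ℤ, A ≠ 0 → B ≠ 0 → C ≠ 0 →
      {t : ℤ × ℤ × ℤ | ({t.1, t.2.1, t.2.2} : Finset ℤ).gcd id = 1 ∧
        A * t.1 ^ 2 + B * t.2.1 ^ 3 = C * t.2.2 ^ (2 * m)}.Finite := fun A B C hA hB hC =>
    finite_properSolutions_signature_two_three_even_of_faltings (by omega) hFaltings hA hB hC
  exact forall_finite_properSolutions_swap₁₂ (forall_finite_properSolutions_swap₂₃ h23) A B C hA hB hC

end DarmonGranville

end Literature.NumberTheory.DiophantineGeometry
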